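import Mathlib
import Summits.ABC.ABC.Theses.RibetTakahashiSplit
import Literature.NumberTheory.Automorphic.ShimuraCurve
import Literature.NumberTheory.EllipticCurves.ModularCurve
import Literature.NumberTheory.EllipticCurves.GlobalMinimalModel
import Literature.NumberTheory.EllipticCurves.Szpiro
import Summits.ABC.ABC.Theorems.RibetTakahashiSplitManyPrimeValuationProductCoveringGlue

/-!
# Line `SketchIdeator1` (card `waldspurger-localisation`) — skeleton for crux
# `RibetTakahashiSplit.ManyPrimeValuationProductSemistableFrey` (stmt-ABC-15174, route-ABC-RibetTakahashiSplit, rank 2)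

THE CRUX. `T(E) := ∏_{p ∥ N} ord_p(Δ_min) ≤ C_ε N^ε` for every `E/ℚ` SEMISTABLE (`p² ∤ N` for every `p`),
`ℚ`-isomorphic to a twisted Frey–Hellegouarch curve, with `≥ 4` odd multiplicative primes.

THE LINE (card `Ideas/waldspurger-localisation.md`, sketch `SketchIdeator1.lean`, lead rev L1). For a covering
set `D` (co-level `M = N/∏D`), a Néron period pair `L`, a Shimura curve datum `S = X_0^{∏D}(M)` and a non-zero
weight-2 form `s` on `S.Gamma` with periods in the Néron lattice (on the semistable class `s ∈ ℤ·s_gen`,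
multiplicity one: no twist directions since `N = ∏D · M` is squarefree), the refined Ribet–Takahashi–Pasten
PACKAGE (`stub_jlPackageSF`, KNOWN in print: Pasten arXiv:1705.09251 Thm 6.1 (b.1) + §16, closed modulo the
11 named facts of `Theorems/…JLPackagePrintedClass.lean`) reads
  `log T_D ≤ C + ε log N + log vol(F) − log ∫_F ‖s‖²_pt`,
so the crux per covering set is the MINIMAL LEVER `MeanSquareLowerBoundSF` ("JL preserves integral size":
`log mean_F ‖s‖²_pt ≥ −(ε log N + C)`).  The card LOCALISES it to one CM sample: with
`Z_d` = a complete irredundant system of representatives modulo `Γ` of the CM points of `S` of exact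
discriminant `−d` (`−d` an odd fundamental discriminant prime to `N`; typed over `ShimuraCurveData.heckeSet`),
  (B, ARITHMETIC, OPEN — `stub_orbitLowerBound`, the lead's) some `d ≤ C N^ε` has
      `log mean_{Z_d} ‖s‖²_pt ≥ −(ε log N + C)`  (Pasten's CM floor Prop 14.2/Thm 13.2 WITHOUT its deficit `log(d D M²)`);
  (A, ANALYTIC — `stub_orbitUpperBound = OrbitUpperBound 0`) every such sample has
      `log mean_{Z_d} ‖s‖²_pt ≤ ε log N + ε log d + C + log mean_F ‖s‖²_pt`
      (Waldspurger / Yuan–Zhang–Zhang Thm 1.4 + Parseval over `Cl(−d)^∨` + GLH for `L(1/2, f_E × θ_χ)` +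
       Hoffstein–Lockhart + Siegel; convexity gives the rung `OrbitUpperBound (1/2)`, Pasten Thm 8.1 the rung `θ = 1`);
  squeeze (`meanSquareSF_of_orbit`, PROVED) ⟹ `MeanSquareLowerBoundSF` ⟹ (`pairedSF_of_meanSquare`, PROVED, with
  the Fermat input `stub_fermatInputSF` — KNOWN: Wiles + Ribet 1997 + Darmon–Merel, reduction landed p82851/p88991)
  `PairedFactorisationBoundSF` ⟹ (`coveringGlueSF`, PROVED: three covering sets, Theorems/…CoveringGlue.lean) the crux.
`ManyPrimeValuationProductSemistableFrey_of` composes the four load-bearing stubs into the crux BY NAME; the fifth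
registered stub `stub_heegnerPatternBudgetCRT : HeegnerPatternBudget 1` is CALIBRATION (θ = 1 rung of the size
half of (B): a field `ℚ(√−d)`, `d ≤ N`, with any prescribed splitting at the odd primes of `N` — CRT, provable now;
`θ = 0` is GRH-strength and is where `2^{ω(N)} ≤ N^{1/log log N}` enters) and is not invoked by `_of`.

## Disproof used
No `Disproof.lean` for stmt-ABC-15174 exists yet (payload path not mounted; crux dir has none, 2026-08-16T12:40Z).
The parent `Cruxes/ManyPrimeValuationProduct/Disproof.lean` (cdisprove-stmt-ABC-1561 §§1–7 + Targets + g3) applies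
verbatim to this sub-class and is HONOURED: every statement is `∀ ε > 0 ∃ C` (§3 `_false_without_epsilon`,
`_false_uniform_constant`, §4 `_false_polylog`, `Negative/ConstantBlowup`, `Negative/CruxConstantDoublyExponential`:
`C_ε ≥ exp exp(1/(12ε))` — (B)'s `C` inherits this through the least Heegner `d ≥ 2^{ω}` and Siegel); integrality
enters only through `HasPeriodsIn … Λ_E` (`Negative/JlScaling.not_exists_uniform_mean_log_lower_bound`: a
period-free lower bound is false by scaling — (B) is stated for Néron-period forms only, (A) is scale-free);
no defect statement (`Negative/DefectScaling` not engaged); §2/§5: (B) is crux_D-equivalent under GLH + first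
moment (card §Transfer), not weaker than the crux, not refutable short of `¬ABC ∨ ¬GLH ∨` vanishing of all
`h(−d)` central values at every `d ≤ N^ε`.
-/

set_option linter.dupNamespace false

noncomputable section

open MeasureTheory
open scoped MatrixGroups

namespace Summit.ABC.ABC.Cruxes.ManyPrimeValuationProductSemistableFrey.WaldspurgerLocalisation

open Literature.NumberTheory.Automorphic
open Literature.NumberTheory.EllipticCurves.ModularForms (IsNeronLatticeOf)
open Literature.NumberTheory.EllipticCurves (freyCurve)
open Summit.ABC.ABC.Theses.RibetTakahashiSplit (ManyPrimeValuationProductSemistableFrey)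

/-! ## Arithmetic vocabulary (verbatim from the sketch / the parent line) -/

/-- Multiplicative primes: `p ∣ N`, `p² ∤ N`. -/
def multPrimes (W : WeierstrassCurve ℚ) : Finset ℕ :=
  (W.conductorNorm ℤ).primeFactors.filter (fun p => ¬ p ^ 2 ∣ W.conductorNorm ℤ)

/-- `T_D(E) = ∏_{p ∈ D} ord_p Δ_min`. -/
def valProd (W : WeierstrassCurve ℚ) (D : Finset ℕ) : ℕ :=
  ∏ p ∈ D, (W.minimalDiscriminantNorm ℤ).factorization p

/-- Semistable: `p² ∤ N` for every prime (the crux's first hypothesis, verbatim). -/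
def IsSemistable (W : WeierstrassCurve ℚ) : Prop :=
  ∀ p : ℕ, p.Prime → ¬ p ^ 2 ∣ W.conductorNorm ℤ

/-- `ℚ`-isomorphic to a twisted Frey–Hellegouarch curve (the crux's second hypothesis, verbatim). -/
def IsFreyIsomorphic (W : WeierstrassCurve ℚ) : Prop :=
  ∃ (a b d : ℤ) (C' : WeierstrassCurve.VariableChange ℚ), IsCoprime a b ∧ a * b * (a + b) ≠ 0 ∧
    d ∣ 2 ∧ C' • W = freyCurve (d * a) (d * b)

/-- Covering set (admissibility inside): `D ⊆` multiplicative primes, `#D` even, `≥ 2`, and `≥ 2`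
multiplicative primes outside `D` (Pasten (b.1): `M` not prime). -/
def IsCoveringSet (W : WeierstrassCurve ℚ) (D : Finset ℕ) : Prop :=
  D ⊆ multPrimes W ∧ Even D.card ∧ 2 ≤ D.card ∧ 2 ≤ (multPrimes W \ D).card

/-- `D' = ∏_{p ∈ D} p`. -/
def discOf (D : Finset ℕ) : ℕ := ∏ p ∈ D, p

/-- FERMAT INPUT at a curve (Pasten Thm 6.17): for every prime `ℓ ≥ 11` some multiplicative prime `r`
has `ℓ ∤ ord_r(Δ_min)`. -/
def FermatInput (W : WeierstrassCurve ℚ) : Prop :=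
  ∀ ℓ : ℕ, ℓ.Prime → 11 ≤ ℓ → ∃ r ∈ multPrimes W, ¬ ℓ ∣ (W.minimalDiscriminantNorm ℤ).factorization r

/-- Pointwise Petersson norm `‖s‖²_pt(z) = |s(z)|² (Im z)²`. -/
def pet {Γ : Subgroup (GL (Fin 2) ℝ)} (s : CuspForm Γ 2) (z : UpperHalfPlane) : ℝ :=
  ‖s z‖ ^ 2 * z.im ^ 2

/-- `L` is a Néron period pair of `W` (period pair of the invariant differential of a globally
minimal model). -/
def IsNeronPeriodPairOf (W : WeierstrassCurve ℚ) (L : PeriodPair) : Prop :=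
  ∃ C : WeierstrassCurve.VariableChange ℚ,
    (C • W).IsGloballyMinimal ∧ IsNeronLatticeOf ((C • W).baseChange ℂ) L

/-! ## CM samples on `X_0^D(M)` (the localisation vocabulary, rev L1) -/

/-- `z ∈ ℍ` is a CM point of `S` of EXACT discriminant `−d`: some `g = ι(x)`, `x ∈ O`, of reduced
norm `det g = n` and reduced trace `t = tr g` with `t² − 4n = −d` fixes `z` (so `ℤ[x]` is the
imaginary quadratic order of discriminant `−d` and `g` is elliptic).  For `−d` FUNDAMENTAL the order
`ℚ(x) ∩ O ⊇ ℤ[x] = O_K` is maximal, i.e. the embedding is optimal: these are the Heegner points of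
`K = ℚ(√−d)` on `X_0^D(M)` (empty unless every `p ∣ D` is inert and every `p ∣ M` splits in `K`). -/
def IsCMPointOfDisc {D M : ℕ} (S : ShimuraCurveData D M) (d : ℕ) (z : UpperHalfPlane) : Prop :=
  ∃ n : ℕ, ∃ g ∈ S.heckeSet n, g • z = z ∧
    (g : Matrix (Fin 2) (Fin 2) ℝ).trace ^ 2 + (d : ℝ) = 4 * (n : ℝ)

/-- `Z` is a COMPLETE CM SAMPLE of discriminant `−d`: a finite set of CM points of exact discriminant
`−d`, pairwise `Γ`-inequivalent, meeting every `Γ`-orbit of such points (a system of representatives of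
the CM points of discriminant `−d` on the curve `Γ\ℍ`; `‖s‖²_pt` is `Γ`-invariant, so sample means do
not depend on the representatives).  For fundamental `−d` it is the union over the `2^{ω(DM)}`
orientations of the Galois orbits `{x_σ}_{σ ∈ Cl(−d)}` of Heegner points. -/
def IsCMSample {D M : ℕ} (S : ShimuraCurveData D M) (d : ℕ) (Z : Finset UpperHalfPlane) : Prop :=
  (∀ z ∈ Z, IsCMPointOfDisc S d z) ∧
  (∀ z ∈ Z, ∀ z' ∈ Z, ∀ γ ∈ S.Gamma, γ • z = z' → z = z') ∧
  (∀ w : UpperHalfPlane, IsCMPointOfDisc S d w → ∃ z ∈ Z, ∃ γ ∈ S.Gamma, γ • w = z)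

/-- Admissible sample discriminants for level `N`: `−d` is an ODD FUNDAMENTAL discriminant prime to `N`
(`d ≡ 3 (mod 4)` squarefree, `gcd(d, N) = 1`; on the class `2 ∥ N`, so `K = ℚ(√−d)` is unramified at
every prime of `N`). -/
def IsSampleDisc (N d : ℕ) : Prop :=
  Squarefree d ∧ d % 4 = 3 ∧ Nat.Coprime d N

/-! ## The statements -/

/-- **Statement of stub 1 — FERMAT INPUT on the semistable Frey class** (KNOWN: Pasten L.6.12 = Wiles +
Ribet 1997 + Darmon–Merel on `x^ℓ + 2^m y^ℓ + z^ℓ = 0`; in tree modulo the named facts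
`FermatLastTheorem`, `ribet1997_twoPowerFermat`, `darmonMerel1997_denesEquation` via
`genFermat_two_power_trivial` + `exists_not_dvd_factorization_of_smul_eq_freyCurve`, landed p82851/p88991). -/
def FermatInputSF : Prop :=
  ∀ (W : WeierstrassCurve ℚ) [W.IsElliptic], IsSemistable W → IsFreyIsomorphic W →
    4 ≤ (multPrimes W).card → FermatInput W

/-- **Statement of stub 2 — the Ribet–Takahashi–Pasten PACKAGE on the semistable (Frey) class** (KNOWN in
print: Pasten arXiv:1705.09251 Thm 6.1 (b.1) + §16; = `jlPackage_printedClass_of_facts` with `Or.inl`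
semistable, modulo its 11 named facts).  For every `ε > 0` there is `C` such that for every admissible
`(W, D)` there are a Néron period pair `L`, a datum `S` of level `(∏D, N/∏D)`, a fundamental domain `F` of
finite positive area and a NON-ZERO weight-2 form `s` on `S.Gamma` with periods in the Néron lattice,
`‖s‖²_pt` and `log ‖s‖²_pt` integrable on `F`, `‖s‖²_pt > 0` a.e., with
`log T_D ≤ C + ε log N + log vol(F) − log ∫_F ‖s‖²_pt`. -/
def JLPackageSF : Prop :=
  ∀ ε : ℝ, 0 < ε → ∃ C : ℝ, ∀ (W : WeierstrassCurve ℚ) [W.IsElliptic],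
    IsSemistable W → IsFreyIsomorphic W → FermatInput W → ∀ D : Finset ℕ, IsCoveringSet W D →
      ∃ (L : PeriodPair) (S : ShimuraCurveData (discOf D) (W.conductorNorm ℤ / discOf D))
        (F : Set UpperHalfPlane) (s : CuspForm S.Gamma 2),
        IsNeronPeriodPairOf W L ∧ IsHypFundamentalDomain S.Gamma F ∧ volume F ≠ 0 ∧ volume F ≠ ⊤ ∧
        s ≠ 0 ∧ HasPeriodsIn S.Gamma s (L.lattice : Set ℂ) ∧
        IntegrableOn (pet s) F ∧ IntegrableOn (fun z => Real.log (pet s z)) F ∧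
        (∀ᵐ z ∂(volume.restrict F), 0 < pet s z) ∧ (0 < ∫ z in F, pet s z) ∧
        Real.log (valProd W D) ≤ C + ε * Real.log (W.conductorNorm ℤ) +
          Real.log (volume F).toReal - Real.log (∫ z in F, pet s z)

/-- **Statement of stub 3 — ORBIT LOWER BOUND (B, arithmetic half, OPEN, the lead's).**  For every
`ε > 0` there is `C` such that for every admissible `(W, D, L, S)` and every non-zero weight-2 form `s` on
`S.Gamma` with periods in the Néron lattice there are an admissible sample discriminant `d ≤ C N^ε` and a
complete CM sample `Z` of discriminant `−d`, non-empty, with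
`(#Z)⁻¹ Σ_{z ∈ Z} ‖s‖²_pt(z) ≥ exp(−(ε log N + C))` (multiplicative form: `Real.log 0 = 0` would make a
`log`-form vacuously satisfiable by a sample on which `s` vanishes).
= the card's `C⁺` `OrbitMeanSquareLowerBound` over a canonical sample.  Pasten Prop 14.2 + Thm 13.2 give,
for every non-zero INTEGRAL form at a Heegner orbit where it does not vanish, the floor
`GM_σ log ‖F(x_σ)‖ ≥ −log(2M) − h_Ar(P_K)`, `h_Ar = L′/L(1,χ_K) + ½ log(dD) + O(1)`: the stub asks for the
floor WITHOUT the deficit `log(d D M²)`, at SOME tiny non-vanishing orbit (`2^{ω(N)} ≤ N^{o(1)}` patterns). -/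
def OrbitLowerBound : Prop :=
  ∀ ε : ℝ, 0 < ε → ∃ C : ℝ, ∀ (W : WeierstrassCurve ℚ) [W.IsElliptic],
    IsSemistable W → IsFreyIsomorphic W → ∀ D : Finset ℕ, IsCoveringSet W D →
    ∀ (L : PeriodPair), IsNeronPeriodPairOf W L →
    ∀ (S : ShimuraCurveData (discOf D) (W.conductorNorm ℤ / discOf D)),
    ∀ (s : CuspForm S.Gamma 2), s ≠ 0 → HasPeriodsIn S.Gamma s (L.lattice : Set ℂ) →
      ∃ d : ℕ, IsSampleDisc (W.conductorNorm ℤ) d ∧ (d : ℝ) ≤ C * (W.conductorNorm ℤ : ℝ) ^ ε ∧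
        ∃ Z : Finset UpperHalfPlane, IsCMSample S d Z ∧ Z.Nonempty ∧
          Real.exp (-(ε * Real.log (W.conductorNorm ℤ) + C)) ≤ (Z.card : ℝ)⁻¹ * ∑ z ∈ Z, pet s z

/-- **Statement of stub 4 — ORBIT UPPER BOUND at exponent `θ` (A, analytic half).**  For every `ε > 0`
there is `C` such that for every admissible `(W, D, L, S, F, s)` (`‖s‖²_pt` integrable on `F` with positive
integral), every admissible sample discriminant `d` and every non-empty complete CM sample `Z` of
discriminant `−d`:
`(#Z)⁻¹ Σ_{z ∈ Z} ‖s‖²_pt(z) ≤ exp((θ + ε) log N + ε log d + C) · (vol F)⁻¹ ∫_F ‖s‖²_pt`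
(multiplicative form, so that a sample on which `s` vanishes is harmless: `Real.log 0 = 0`).
`θ = 0`: Waldspurger/YZZ Thm 1.4 for the JL line (`s ∈ ℂ F`, multiplicity one on the semistable class) +
Parseval over `Cl(−d)^∨` + GLH for `L(1/2, π_{f,K} ⊗ χ)` + `L(1, ad f) ≫ N^{−ε}` (Hoffstein–Lockhart) +
Siegel; `θ = 1/2`: convexity (unconditional in print); `θ = 1`: `mean_Z ≤ sup ≤ (4/π) ∫_F` (Pasten Thm 8.1,
PROVED in tree for torsion-free `Γ`) + `vol F ≤ C N^{1+ε}` (Shimizu). Scale-free in `s`. -/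
def OrbitUpperBound (θ : ℝ) : Prop :=
  ∀ ε : ℝ, 0 < ε → ∃ C : ℝ, ∀ (W : WeierstrassCurve ℚ) [W.IsElliptic],
    IsSemistable W → IsFreyIsomorphic W → ∀ D : Finset ℕ, IsCoveringSet W D →
    ∀ (L : PeriodPair), IsNeronPeriodPairOf W L →
    ∀ (S : ShimuraCurveData (discOf D) (W.conductorNorm ℤ / discOf D)) (F : Set UpperHalfPlane),
      IsHypFundamentalDomain S.Gamma F → volume F ≠ 0 → volume F ≠ ⊤ →
    ∀ (s : CuspForm S.Gamma 2), s ≠ 0 → HasPeriodsIn S.Gamma s (L.lattice : Set ℂ) →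
      IntegrableOn (pet s) F → (0 < ∫ z in F, pet s z) →
    ∀ d : ℕ, IsSampleDisc (W.conductorNorm ℤ) d →
    ∀ Z : Finset UpperHalfPlane, IsCMSample S d Z → Z.Nonempty →
      (Z.card : ℝ)⁻¹ * ∑ z ∈ Z, pet s z ≤
        Real.exp ((θ + ε) * Real.log (W.conductorNorm ℤ) + ε * Real.log d + C) *
          ((volume F).toReal⁻¹ * ∫ z in F, pet s z)

/-- The MINIMAL LEVER on the semistable Frey class ("JL preserves integral size", sketch verbatim):
`log((vol F)⁻¹ ∫_F ‖s‖²_pt) ≥ −(ε log N + C)` for every admissible Néron-period form. -/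
def MeanSquareLowerBoundSF : Prop :=
  ∀ ε : ℝ, 0 < ε → ∃ C : ℝ, ∀ (W : WeierstrassCurve ℚ) [W.IsElliptic],
    IsSemistable W → IsFreyIsomorphic W → ∀ D : Finset ℕ, IsCoveringSet W D →
    ∀ (L : PeriodPair), IsNeronPeriodPairOf W L →
    ∀ (S : ShimuraCurveData (discOf D) (W.conductorNorm ℤ / discOf D)) (F : Set UpperHalfPlane),
      IsHypFundamentalDomain S.Gamma F → volume F ≠ 0 → volume F ≠ ⊤ →
    ∀ (s : CuspForm S.Gamma 2), s ≠ 0 → HasPeriodsIn S.Gamma s (L.lattice : Set ℂ) →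
      IntegrableOn (pet s) F → (0 < ∫ z in F, pet s z) →
        -(ε * Real.log (W.conductorNorm ℤ) + C) ≤
          Real.log ((volume F).toReal⁻¹ * ∫ z in F, pet s z)

/-- The PER-COVERING-SET bound on the class: `T_D ≤ C_ε N^ε`. -/
def PairedFactorisationBoundSF : Prop :=
  ∀ ε : ℝ, 0 < ε → ∃ C : ℝ, ∀ (W : WeierstrassCurve ℚ) [W.IsElliptic],
    IsSemistable W → IsFreyIsomorphic W → ∀ D : Finset ℕ, IsCoveringSet W D →
      (valProd W D : ℝ) ≤ C * (W.conductorNorm ℤ : ℝ) ^ ε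

/-- **HEEGNER PATTERN BUDGET at exponent `θ`** (sketch verbatim): for every squarefree `N` and sign
pattern `σ` on its odd primes there is `0 < d ≤ C N^{θ+ε}` with `(−d / p) = ±1` as prescribed by `σ` at
every odd `p ∣ N`.  `θ = 1`: CRT (stub 5, provable now); `θ = 0`: GRH-strength (Lamzouri–Li–Soundararajan). -/
def HeegnerPatternBudget (θ : ℝ) : Prop :=
  ∀ ε : ℝ, 0 < ε → ∃ C : ℝ, ∀ N : ℕ, Squarefree N → ∀ σ : ℕ → Bool,
    ∃ d : ℕ, 0 < d ∧ (d : ℝ) ≤ C * (N : ℝ) ^ (θ + ε) ∧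
      ∀ p ∈ N.primeFactors, p ≠ 2 →
        jacobiSym (-(d : ℤ)) p ≠ 0 ∧ (jacobiSym (-(d : ℤ)) p = 1 ↔ σ p = true)

/-! ## The five registered stubs -/

/-- **Stub 1 — Fermat input on the semistable Frey class** (`FermatInputSF`; KNOWN in print, in tree modulo
`FermatLastTheorem` + `ribet1997_twoPowerFermat` + `darmonMerel1997_denesEquation`). Size: S given the
landed reduction; unconditional closure = FLT technology. -/
theorem stub_fermatInputSF : FermatInputSF := by
  sorry

/-- **Stub 2 — the Ribet–Takahashi–Pasten package on the semistable class** (`JLPackageSF`; KNOWN in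
print; in tree = `jlPackage_printedClass_of_facts` modulo 11 named facts). Size: S given that file; XL
unconditionally (Shimura-curve programme). -/
theorem stub_jlPackageSF : JLPackageSF := by
  sorry

/-- **Stub 3 — orbit lower bound** (`OrbitLowerBound`; OPEN — the arithmetic core; the lead's). -/
theorem stub_orbitLowerBound : OrbitLowerBound := by
  sorry

/-- **Stub 4 — orbit upper bound at `θ = 0`** (`OrbitUpperBound 0`; Waldspurger + GLH). -/
theorem stub_orbitUpperBound : OrbitUpperBound 0 := by
  sorry

/-- **Stub 5 (CALIBRATION, not invoked by `_of`) — the Heegner pattern budget at `θ = 1`** (CRT; provable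
now: choose `d (mod p)` in the prescribed class at each odd `p ∣ N`, least positive solution `≤ N`). -/
theorem stub_heegnerPatternBudgetCRT : HeegnerPatternBudget 1 := by
  sorry

/-! ## Elementary lemmas -/

/-- A covering set forces `≥ 4` multiplicative primes. -/
theorem four_le_card_multPrimes {W : WeierstrassCurve ℚ} {D : Finset ℕ} (hD : IsCoveringSet W D) :
    4 ≤ (multPrimes W).card := by
  obtain ⟨hsub, -, h2, h2'⟩ := hD
  have h := Finset.card_sdiff_add_card_eq_card hsub
  omega

/-- `T_D ≥ 1` on covering sets (every factor is `≥ 1`). -/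
theorem one_le_valProd {W : WeierstrassCurve ℚ} [W.IsElliptic] {D : Finset ℕ}
    (hD : IsCoveringSet W D) : 1 ≤ valProd W D := by
  unfold valProd
  exact Finset.one_le_prod' fun p hp =>
    Summit.ABC.ABC.Theorems.ManyPrimeValuationProduct.one_le_factorization_of_mem_filter W (hD.1 hp)

/-! ## The squeeze (PROVED): (B) ∧ (A at θ = 0) ⟹ the minimal lever -/

/-- **Localisation glue.**  With `e = ε/(2+ε)`: (B) gives `d ≤ C_B N^e` and a sample with
`log mean_Z ≥ −(e log N + C_B)`; (A) gives `log mean_Z ≤ e log N + e log d + C_A + log mean_F`; and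
`log d ≤ log C_B + e log N`; so `log mean_F ≥ −((2e + e²) log N + const) ≥ −(ε log N + const)`. [folklore] -/
theorem meanSquareSF_of_orbit (hB : OrbitLowerBound) (hA : OrbitUpperBound 0) :
    MeanSquareLowerBoundSF := by
  intro ε hε
  set e : ℝ := ε / (2 + ε) with he
  have he0 : 0 < e := by positivity
  obtain ⟨CB, hCB⟩ := hB e he0
  obtain ⟨CA, hCA⟩ := hA e he0
  refine ⟨CB + e * |Real.log CB| + CA, fun W _ hss hfr D hD L hL S F hFD hF0 hFt s hs0 hper hint hI => ?_⟩
  obtain ⟨d, hd, hdle, Z, hZ, hZne, hlow⟩ := hCB W hss hfr D hD L hL S s hs0 hper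
  have hup := hCA W hss hfr D hD L hL S F hFD hF0 hFt s hs0 hper hint hI d hd Z hZ hZne
  set Nr : ℝ := (W.conductorNorm ℤ : ℝ) with hNr
  set m : ℝ := (Z.card : ℝ)⁻¹ * ∑ z ∈ Z, pet s z with hm
  set V : ℝ := (volume F).toReal with hVdef
  set I : ℝ := ∫ z in F, pet s z with hIdef
  have hV : 0 < V := ENNReal.toReal_pos hF0 hFt
  have hg : 0 < V⁻¹ * I := mul_pos (inv_pos.mpr hV) hI
  have hN0 : 0 < W.conductorNorm ℤ := W.conductorNorm_pos_holds
  have hN1 : (1 : ℝ) ≤ Nr := by rw [hNr]; exact_mod_cast hN0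
  have hNpos : 0 < Nr := by linarith
  have hL : 0 ≤ Real.log Nr := Real.log_nonneg hN1
  have hd3 : (3 : ℝ) ≤ d := by
    have h3 : 3 ≤ d := by have := hd.2.1; omega
    exact_mod_cast h3
  have hdpos : (0 : ℝ) < d := by linarith
  have hCBpos : 0 < CB := by
    by_contra hle
    push Not at hle
    have : CB * Nr ^ e ≤ 0 := mul_nonpos_of_nonpos_of_nonneg hle (Real.rpow_nonneg hNpos.le _)
    linarith
  have hlogd : Real.log d ≤ Real.log CB + e * Real.log Nr := by
    calc Real.log d ≤ Real.log (CB * Nr ^ e) := Real.log_le_log hdpos hdle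
      _ = Real.log CB + e * Real.log Nr := by
          rw [Real.log_mul hCBpos.ne' (Real.rpow_pos_of_pos hNpos _).ne', Real.log_rpow hNpos]
  have hlogCB : Real.log CB ≤ |Real.log CB| := le_abs_self _
  have h1 : e * Real.log d ≤ e * |Real.log CB| + e * e * Real.log Nr := by
    have h' : Real.log d ≤ |Real.log CB| + e * Real.log Nr := by linarith
    have := mul_le_mul_of_nonneg_left h' he0.le
    linarith [this]
  have hee : 2 * e + e * e ≤ ε := by
    have h' : e ≤ ε := by rw [he]; exact div_le_self hε.le (by linarith)
    have h'' : e * (2 + ε) = ε := by rw [he]; field_simp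
    nlinarith
  have h2 : (2 * e + e * e) * Real.log Nr ≤ ε * Real.log Nr := mul_le_mul_of_nonneg_right hee hL
  -- logarithms of the two halves
  have hmpos : 0 < m := lt_of_lt_of_le (Real.exp_pos _) hlow
  have hlow' : -(e * Real.log Nr + CB) ≤ Real.log m := by
    have := Real.log_le_log (Real.exp_pos _) hlow
    rwa [Real.log_exp] at this
  have hup' : Real.log m ≤ (0 + e) * Real.log Nr + e * Real.log d + CA + Real.log (V⁻¹ * I) := by
    have := Real.log_le_log hmpos hup
    rwa [Real.log_mul (Real.exp_pos _).ne' hg.ne', Real.log_exp] at this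
  simp only [zero_add] at hup'
  linarith [hlow', hup', h1, h2]

/-! ## The package consumed directly (PROVED): minimal lever ⟹ per-covering-set bound -/

/-- `log T_D ≤ C₁ + (ε/2) log N + log V − log I = C₁ + (ε/2) log N − log(V⁻¹ I) ≤ C₁ + C₂ + ε log N`.
[folklore] -/
theorem pairedSF_of_meanSquare (hFI : FermatInputSF) (hJL : JLPackageSF) (hM : MeanSquareLowerBoundSF) :
    PairedFactorisationBoundSF := by
  intro ε hε
  have hε2 : 0 < ε / 2 := half_pos hε
  obtain ⟨C₁, hC₁⟩ := hJL (ε / 2) hε2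
  obtain ⟨C₂, hC₂⟩ := hM (ε / 2) hε2
  refine ⟨Real.exp (C₁ + C₂), fun W _ hss hfr D hD => ?_⟩
  have hF : FermatInput W := hFI W hss hfr (four_le_card_multPrimes hD)
  obtain ⟨L, S, F, s, hL, hFD, hF0, hFt, hs0, hper, hint₁, -, -, hIpos, hineq⟩ :=
    hC₁ W hss hfr hF D hD
  have hm := hC₂ W hss hfr D hD L hL S F hFD hF0 hFt s hs0 hper hint₁ hIpos
  set N : ℝ := (W.conductorNorm ℤ : ℝ) with hNdef
  set V : ℝ := (volume F).toReal with hVdef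
  set I : ℝ := ∫ z in F, pet s z with hIdef
  have hV : 0 < V := ENNReal.toReal_pos hF0 hFt
  have hlogVI : Real.log (V⁻¹ * I) = Real.log I - Real.log V := by
    rw [Real.log_mul (inv_ne_zero hV.ne') hIpos.ne', Real.log_inv]; ring
  rw [hlogVI] at hm
  have hlogT : Real.log (valProd W D) ≤ C₁ + C₂ + ε * Real.log N := by linarith
  have hN0 : 0 < W.conductorNorm ℤ := W.conductorNorm_pos_holds
  have hN : 0 < N := by rw [hNdef]; exact_mod_cast hN0
  have hT : (valProd W D : ℝ) ≤ Real.exp (Real.log (valProd W D)) := by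
    rcases Nat.eq_zero_or_pos (valProd W D) with h | h
    · rw [h]; simp
    · rw [Real.exp_log (by exact_mod_cast h)]
  calc (valProd W D : ℝ) ≤ Real.exp (Real.log (valProd W D)) := hT
    _ ≤ Real.exp (C₁ + C₂ + ε * Real.log N) := Real.exp_le_exp.mpr hlogT
    _ = Real.exp (C₁ + C₂) * N ^ ε := by
        rw [Real.exp_add, Real.rpow_def_of_pos hN, mul_comm (Real.log N) ε]

/-! ## The covering glue on the class (PROVED) -/

/-- **Covering glue.** `PairedFactorisationBoundSF` implies the crux: with `≥ 4` odd multiplicative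
primes the multiplicative primes are covered by three covering sets (`exists_three_coveringSets`,
Theorems/…CoveringGlue.lean) and `T ≤ T_{D₁} T_{D₂} T_{D₃} ≤ (max C 1)³ N^ε` at `ε/3`. [folklore] -/
theorem coveringGlueSF (hP : PairedFactorisationBoundSF) : ManyPrimeValuationProductSemistableFrey := by
  intro ε hε
  obtain ⟨C, hC⟩ := hP (ε / 3) (by positivity)
  refine ⟨(max C 1) ^ 3, fun W _ hss hfr h4 => ?_⟩
  set S := (W.conductorNorm ℤ).primeFactors.filter (fun p => ¬ p ^ 2 ∣ W.conductorNorm ℤ) with hS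
  have hS4 : 4 ≤ S.card := by
    refine le_trans h4 (Finset.card_le_card fun p hp => ?_)
    simp only [hS, Finset.mem_filter] at hp ⊢
    exact ⟨hp.1, hp.2.2⟩
  obtain ⟨D₁, D₂, D₃, hD₁, hD₂, hD₃, hprod⟩ :=
    Summit.ABC.ABC.Theorems.ManyPrimeValuationProduct.exists_three_coveringSets W hS4
  have hN0' : 0 < W.conductorNorm ℤ := W.conductorNorm_pos_holds
  set N : ℝ := (W.conductorNorm ℤ : ℝ) with hNdef
  have hN0 : 0 < N := by rw [hNdef]; exact_mod_cast hN0'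
  have hb : ∀ D, (D ⊆ S ∧ Even D.card ∧ 2 ≤ D.card ∧ 2 ≤ (S \ D).card) →
      ((∏ p ∈ D, (W.minimalDiscriminantNorm ℤ).factorization p : ℕ) : ℝ) ≤ max C 1 * N ^ (ε / 3) :=
    fun D hD => (hC W hss hfr D hD).trans
      (mul_le_mul_of_nonneg_right (le_max_left _ _) (Real.rpow_nonneg hN0.le _))
  have hpow : (N ^ (ε / 3)) ^ (3 : ℕ) = N ^ ε := by
    rw [← Real.rpow_natCast, ← Real.rpow_mul hN0.le]; norm_num
  change ((∏ p ∈ S, (W.minimalDiscriminantNorm ℤ).factorization p : ℕ) : ℝ) ≤ (max C 1) ^ 3 * N ^ ε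
  calc ((∏ p ∈ S, (W.minimalDiscriminantNorm ℤ).factorization p : ℕ) : ℝ)
        ≤ ((∏ p ∈ D₁, (W.minimalDiscriminantNorm ℤ).factorization p : ℕ) : ℝ) *
            ((∏ p ∈ D₂, (W.minimalDiscriminantNorm ℤ).factorization p : ℕ) : ℝ) *
            ((∏ p ∈ D₃, (W.minimalDiscriminantNorm ℤ).factorization p : ℕ) : ℝ) := by
        exact_mod_cast hprod
    _ ≤ (max C 1 * N ^ (ε / 3)) * (max C 1 * N ^ (ε / 3)) * (max C 1 * N ^ (ε / 3)) := by
        gcongr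
        · exact hb D₁ hD₁
        · exact hb D₂ hD₂
        · exact hb D₃ hD₃
    _ = (max C 1) ^ 3 * (N ^ (ε / 3)) ^ (3 : ℕ) := by ring
    _ = (max C 1) ^ 3 * N ^ ε := by rw [hpow]

/-! ## The crux from the line -/

/-- **The crux from the line** — the ONLY theorem of this file concluding
`Summit.ABC.ABC.Theses.RibetTakahashiSplit.ManyPrimeValuationProductSemistableFrey`, BY NAME, no hypotheses;
sorries live only in the `stub_*` it invokes (stubs 1–4; stub 5 is calibration).  Chain:
(B) ∧ (A₀) ⟹ minimal lever (`meanSquareSF_of_orbit`) ⟹ per-covering-set bound (`pairedSF_of_meanSquare`,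
with the Fermat input and the package) ⟹ crux (`coveringGlueSF`). -/
theorem ManyPrimeValuationProductSemistableFrey_of : ManyPrimeValuationProductSemistableFrey :=
  coveringGlueSF (pairedSF_of_meanSquare stub_fermatInputSF stub_jlPackageSF
    (meanSquareSF_of_orbit stub_orbitLowerBound stub_orbitUpperBound))

end Summit.ABC.ABC.Cruxes.ManyPrimeValuationProductSemistableFrey.WaldspurgerLocalisation

end
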